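import Summits.PneNP.PneNP.Theses.SymmetryBudget

/-!
# drefute gen 2 — sub-stub `cutParity` (aux 1/3 of `stub_cutspan`): the hypothesis `hE` is load-bearing

Registered signature (item stmt-PneNP-10637, stubs[], 2026-08-16T04:38Z):
  `{g} (U : Finset (Fin g)) (hU : U.Nonempty) (E : Fin g → Fin g → Prop) (hE : ∀ i j, E i j → i ∈ U ∧ j ∈ U)
   (P : (Fin g → Bool) → Prop) [DecidablePred P]
   (hP : ∀ S, P S ↔ (∀ i, S i = true → i ∈ U) ∧ S (U.min' hU) = true ∧ ∀ i j, E i j → (S i = true ↔ S j = true)) :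
   (∑ S, if P S then (1 : ZMod 2) else 0) = 1 ↔ ∀ i ∈ U, ∀ j ∈ U, (SimpleGraph.fromRel E).Reachable i j`
TRUE as filed (brute force: every U, every E ⊆ U×U, g ≤ 4; see toy/cutparity_check.py). Dropping `hE` makes it
false: g = 3, U = {0,1}, E = {(1,2)}: the closure forces S = {0}, the sum is 1, but 0 and 1 are not reachable.
-/

set_option linter.dupNamespace false

namespace Summit.PneNP.PneNP.Cruxes.HamCompiles.KotzigCutspan.DrefuteG2

/-- The statement of `cutParity` with `hE` dropped. -/
def CutParityWithoutHE : Prop :=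
  ∀ {g : ℕ} (U : Finset (Fin g)) (hU : U.Nonempty) (E : Fin g → Fin g → Prop)
    (P : (Fin g → Bool) → Prop) [DecidablePred P],
    (∀ S, P S ↔ (∀ i, S i = true → i ∈ U) ∧ S (U.min' hU) = true ∧ ∀ i j, E i j → (S i = true ↔ S j = true)) →
    ((∑ S : Fin g → Bool, if P S then (1 : ZMod 2) else 0) = 1 ↔
      ∀ i ∈ U, ∀ j ∈ U, (SimpleGraph.fromRel E).Reachable i j)

/-- Witness data. -/
def U₀ : Finset (Fin 3) := {0, 1}

theorem U₀_nonempty : U₀.Nonempty := ⟨0, by simp [U₀]⟩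

/-- One edge `1 — 2`, leaving `U₀`. -/
def E₀ : Fin 3 → Fin 3 → Prop := fun i j => i = 1 ∧ j = 2

/-- The closure predicate, as a Boolean test. -/
def P₀ (S : Fin 3 → Bool) : Prop := S = fun i => decide (i = 0)

instance : DecidablePred P₀ := fun S => by unfold P₀; infer_instance

theorem U₀_min' : U₀.min' U₀_nonempty = 0 := by decide

theorem P₀_iff (S : Fin 3 → Bool) :
    P₀ S ↔ (∀ i, S i = true → i ∈ U₀) ∧ S (U₀.min' U₀_nonempty) = true ∧
      ∀ i j, E₀ i j → (S i = true ↔ S j = true) := by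
  rw [U₀_min']
  simp only [P₀, E₀, U₀, Finset.mem_insert, Finset.mem_singleton, and_imp]
  constructor
  · rintro rfl
    refine ⟨fun i hi => ?_, by simp, ?_⟩
    · fin_cases i <;> simp_all
    · rintro i j rfl rfl; simp
  · rintro ⟨h1, h0, h2⟩
    funext i
    fin_cases i
    · simpa using h0
    · have h12 := h2 1 2 rfl rfl
      have : S 2 = false := by
        by_contra h
        have := h1 2 (by simpa using h)
        simp at this
      simp only [this] at h12
      simpa using h12
    · show S 2 = decide ((2 : Fin 3) = 0)
      by_contra h
      have := h1 2 (by simpa using h)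
      simp at this

theorem sum_P₀ : (∑ S : Fin 3 → Bool, if P₀ S then (1 : ZMod 2) else 0) = 1 := by
  rw [Finset.sum_ite, Finset.sum_const_zero, add_zero, Finset.sum_const, nsmul_eq_mul, mul_one]
  have : (Finset.univ.filter fun S : Fin 3 → Bool => P₀ S) = {fun i => decide (i = 0)} := by
    ext S; simp [P₀]
  rw [this]; simp

theorem not_reachable_E₀ : ¬ (SimpleGraph.fromRel E₀).Reachable 0 1 := by
  rintro ⟨w⟩
  cases w with
  | cons h _ =>
    rw [SimpleGraph.fromRel_adj] at h
    obtain ⟨-, h | h⟩ := h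
    · exact absurd h.1 (by decide)
    · exact absurd h.2 (by decide)

/-- **Mutation: `cutParity` without `hE` is false.** -/
theorem cutParity_false_without_hE : ¬ CutParityWithoutHE := by
  intro h
  have key := (h U₀ U₀_nonempty E₀ P₀ P₀_iff).1 sum_P₀ 0 (by simp [U₀]) 1 (by simp [U₀])
  exact not_reachable_E₀ key

end Summit.PneNP.PneNP.Cruxes.HamCompiles.KotzigCutspan.DrefuteG2
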